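import Literature.Probability.Percolation.TriCollarSandwichLevel
import Literature.Probability.RandomPlanarGeometry.ConformalRectangleShift

/-!
# Crude Cardy for site percolation on `𝕋` with general slack — Part 1: combinatorics and collar geometry

Support file (`--supports stmt-CriticalPhenomena-5076`) of the line `pinned-diagram-exchange` of the crux
`CardyIKTransport.IKLinearTransport` (stmt-CriticalPhenomena-5076), stub `stub_CrudeCardySiteTri`: crude
Cardy for fair site percolation on the triangular lattice `𝕋` — the probability of an open `𝕋`-path with
all SITES in `Ω` from a site within `sδ` of the arc `A₁` to a site within `sδ` of `A₃` (any slack `s ≥ 0`;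
edges may leave `Ω`) converges to Cardy's value. The lower half is Smirnov's theorem; the upper half
compares the crude event with the open crossings of the "shorter, fatter" marked discrete domains `G⁺` of
Bollobás–Riordan's Lemma 14 (*Percolation* (2006), Ch. 7, p. 184 and (19); the tree's `level_core`,
`TriCollarLevel.lean`). This first part is deterministic:

* `isOpenCrossing_of_run` — the combinatorial heart: a `𝕋`-path of open sites whose off-`G` sites come in
  two mutually non-adjacent kinds (near `A₁`, near `A₃`), starting with the first kind and ending with the
  second, contains an open crossing of `G` from its discrete arc `0` to its discrete arc `2` (run
  extraction, `PathIn.exists_run`), provided sites of `G` adjacent to kind-`0`/kind-`2` sites lie on the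
  discrete arcs `0`/`2`. No plane topology is needed: unlike G02's crossing event, the crude path may poke
  out of `Ω` along its edges, which defeats cross-cut arguments but not this one.
* Collar geometry of the shorter–fatter domain `collarRect R T σp h`: the filled compact
  `Φ(B̄(0, 1 - 2h)) ∪ tube([0, 1] × inner ranges of arcs 1, 3)` is compact and inside the collar domain
  (`isCompact_fill`, `fill_subset_collarRect`); points of `Ω` off it and away from the corners are within
  the tube tolerance of `A₁ ∪ A₃` (`near_arcs_of_not_mem_fill`); points of `A₁ ∪ A₃` away from the
  corners keep off `A₂ ∪ A₄` (`le_dist_of_mem_arc_zero_two`).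

References: B. Bollobás, O. Riordan, *Percolation*, CUP (2006), Ch. 7, Lemma 14 p. 184, (19), (28)–(29)
p. 192, Claim 20 p. 192; S. Smirnov, C. R. Acad. Sci. Paris 333 (2001) 239–244, §2.
-/

noncomputable section

namespace Summit.CriticalPhenomena.CardyFormulaZ2.Theorems.IKLinearTransport.PinnedDiagramExchange

open scoped BigOperators Topology Classical
open Filter Set Function Metric
open Literature.Probability.Percolation Literature.Probability.LatticeModels
open Literature.Probability.RandomPlanarGeometry

/-! ## §1 Combinatorics: a crude crossing read in a marked discrete domain -/

/-- An inner boundary site of a marked discrete domain lies on one of its discrete arcs. [folklore] -/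
theorem exists_mem_arc_of_adj_not_mem (G : TriMarkedDomain 4) {a a' : Site 2} (ha : a ∈ G.verts)
    (ha' : a' ∉ G.verts) (h : triGraph.Adj a a') : ∃ i, a ∈ G.arc i := by
  obtain ⟨n, -, hn⟩ := G.cycle (a, a') (mem_triBdryDarts.2 ⟨ha, ha', h⟩)
  exact ⟨G.stretchIdx n, by have := G.iter_fst_mem_arc n; rwa [hn] at this⟩

/-- **Run extraction for crude crossings.** Let `P` be a `𝕋`-path inside `S ⊆ ω` from `u` to `v`, and let
`Out₀`, `Out₂` be two kinds of sites off the marked discrete domain `G` such that: every site of `S` off `G` is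
of one of the two kinds; no site is of both kinds and no two adjacent sites of `S` are of different kinds;
`u` is of kind `0` and `v` of kind `2`; a site of `G` in `S` adjacent to a kind-`0` (resp. kind-`2`) site
of `S` lies on the discrete arc `0` (resp. `2`). Then `G` has an open crossing from its arc `0` to its
arc `2` in `ω` (the run of `P` inside `G` after its last kind-`0` step). [folklore] -/
theorem isOpenCrossing_of_run : ∀ (G : TriMarkedDomain 4) {ω S : Set (Site 2)} (Out₀ Out₂ : Site 2 → Prop) {u v : Site 2},
    PathIn triGraph S u v → S ⊆ ω → (∀ x ∈ S, x ∉ G.verts → Out₀ x ∨ Out₂ x) → (∀ x, Out₀ x → x ∉ G.verts) →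
    (∀ x, Out₂ x → x ∉ G.verts) → (∀ x ∈ S, ∀ y ∈ S, (x = y ∨ triGraph.Adj x y) → Out₀ x → Out₂ y → False) →
    Out₀ u → Out₂ v → (∀ a ∈ S, ∀ a' ∈ S, a ∈ G.verts → triGraph.Adj a' a → Out₀ a' → a ∈ G.arc 0) →
    (∀ b ∈ S, ∀ b' ∈ S, b ∈ G.verts → triGraph.Adj b b' → Out₂ b' → b ∈ G.arc 2) → G.IsOpenCrossing ω 0 2 := by
  intro G ω S Out₀ Out₂ u v hP hSω hclass h0G h2G h02 hu hv harc0 harc2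
  set H : SimpleGraph (Site 2) := siteOpenGraph triGraph (G.verts : Set (Site 2)) with hH
  have hHadj : ∀ a b, H.Adj a b ↔ triGraph.Adj a b ∧ a ∈ G.verts ∧ b ∈ G.verts := fun a b =>
    siteOpenGraph_adj triGraph _ a b
  have hHG : H ≤ triGraph := fun a b h => ((hHadj a b).1 h).1
  have hvS : v ∈ S := hP.right_mem
  have huS : u ∈ S := hP.left_mem
  obtain ⟨a', a, b, b', ha'S, ha'a, hnH, hL0, hrun, hb'S, hbb', hnH', hnL0, hL2⟩ :=
    PathIn.exists_run (H := H) (L₀ := fun a b => Out₀ a ∨ Out₀ b) (L₂ := fun a b => Out₂ a ∨ Out₂ b) hHG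
      (fun a ha b hb hab => by
        by_cases haG : a ∈ G.verts
        · by_cases hbG : b ∈ G.verts
          · exact Or.inl ((hHadj a b).2 ⟨hab, haG, hbG⟩)
          · rcases hclass b hb hbG with h | h
            · exact Or.inr (Or.inl (Or.inr h))
            · exact Or.inr (Or.inr (Or.inr h))
        · rcases hclass a ha haG with h | h
          · exact Or.inr (Or.inl (Or.inl h))
          · exact Or.inr (Or.inr (Or.inl h)))
      (fun b hb hub => ⟨fun h => h0G u hu ((hHadj u b).1 h).2.1, Or.inl hu⟩)
      (fun a ha hav => ⟨fun h => h2G v hv ((hHadj a v).1 h).2.2, by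
        rintro (h | h)
        · exact h02 a ha v hvS (Or.inr hav) h hv
        · exact h02 v hvS v hvS (Or.inl rfl) h hv⟩)
      (by rintro rfl; exact h02 u huS u huS (Or.inl rfl) hu hv) hP
  have haS : a ∈ S := hrun.left_mem
  have hbS : b ∈ S := hrun.right_mem
  -- `a` is a site of `G`
  have haG : a ∈ G.verts := by
    by_contra haG
    rcases hclass a haS haG with h0 | h2
    · by_cases hab : a = b
      · subst hab
        exact hnL0 (Or.inl h0)
      · obtain ⟨c, -, hac⟩ := hrun.exists_adj_head hab
        exact haG ((hHadj a c).1 hac).2.1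
    · rcases hL0 with h | h
      · exact h02 a' ha'S a haS (Or.inr ha'a) h h2
      · exact h02 a haS a haS (Or.inl rfl) h h2
  have ha'G : a' ∉ G.verts := fun h => hnH ((hHadj a' a).2 ⟨ha'a, h, haG⟩)
  have ha'0 : Out₀ a' := by
    rcases hL0 with h | h
    · exact h
    · exact absurd haG (h0G a h)
  -- `b` is a site of `G`
  have hbG : b ∈ G.verts := by
    by_cases hab : a = b
    · exact hab ▸ haG
    · obtain ⟨c, -, hcb⟩ := hrun.exists_adj_last hab
      exact ((hHadj c b).1 hcb).2.2
  have hb'G : b' ∉ G.verts := fun h => hnH' ((hHadj b b').2 ⟨hbb', hbG, h⟩)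
  have hb'2 : Out₂ b' := by
    rcases hL2 with h | h
    · exact absurd hbG (h2G b h)
    · exact h
  have ha0 : a ∈ G.arc 0 := harc0 a haS a' ha'S haG ha'a ha'0
  have hb2 : b ∈ G.arc 2 := harc2 b hbS b' hb'S hbG hbb' hb'2
  -- the run is a path of `G` inside `ω`
  have key : ∀ w, Relation.ReflTransGen (fun x y => H.Adj x y ∧ y ∈ S) a w →
      Relation.ReflTransGen (fun x y => triGraph.Adj x y ∧ y ∈ ((G.verts : Set (Site 2)) ∩ ω)) a w := by
    intro w h
    induction h with
    | refl => exact Relation.ReflTransGen.refl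
    | tail _ hbc ih => exact ih.tail ⟨((hHadj _ _).1 hbc.1).1, ((hHadj _ _).1 hbc.1).2.2, hSω hbc.2⟩
  exact ⟨a, ha0, b, hb2, ⟨⟨haG, hSω haS⟩, key b hrun.2⟩⟩


/-! ## §2 Geometry of the shorter–fatter collar domain -/

/-- **Points of `Ω` off the filled compact are close to `A₁ ∪ A₃`** (arcs `0`, `2`). Let the tube of
width `2h` be within `tol` of `∂Ω`, let `κ` be a continuity modulus of the boundary loop at scale `ρ/4`,
and let `z ∈ Ω` be at distance `≥ ρ ≥ 4 tol` from the corners and off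
`Φ(B̄(0, 1 - 2h)) ∪ tube([0, 1] × inner ranges of arcs 1, 3)`. Then `z` is within `tol` of `arc 0` or of
`arc 2`. [folklore] -/
theorem near_arcs_of_not_mem_fill (R : ConformalRectangle) (T : R.toJordanDomain.TubeData) {h tol κ ρ : ℝ}
    (hdist : ∀ s t, 1 - 2 * h ≤ s → s ≤ 1 → dist (T.tube s t) (R.boundary t) < tol)
    (hκ : ∀ τ τ' : ℝ, τ ∈ Icc (R.mark 0 - 1) (R.mark 0 + 2) → τ' ∈ Icc (R.mark 0 - 1) (R.mark 0 + 2) →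
      |τ - τ'| < κ → dist (R.boundary τ) (R.boundary τ') < ρ / 4)
    (hh1 : 2 * h ≤ 1) (hκ0 : 0 < κ) (htolρ : 4 * tol ≤ ρ) {z : ℂ} (hz : z ∈ R.carrier) (hfar : ∀ i, ρ ≤ dist z (R.pt i))
    (hK : z ∉ T.Ci.Φ '' closedBall (0 : ℂ) (1 - 2 * h) ∪ (fun q : ℝ × ℝ => T.tube q.1 q.2) ''
      (Icc (0 : ℝ) 1 ×ˢ (Icc (R.mark 1 + κ / 2) (R.nextMark 1 - κ / 2) ∪ Icc (R.mark 3 + κ / 2) (R.nextMark 3 - κ / 2)))) :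
    infDist z (R.arc 0) < tol ∨ infDist z (R.arc 2) < tol := by
  obtain ⟨u, hu, hzu⟩ := T.Ci.bijOn_ball.surjOn hz
  have hu1 : ‖u‖ < 1 := mem_ball_zero_iff.1 hu
  have hularge : 1 - 2 * h < ‖u‖ := by
    by_contra hle
    exact hK (Or.inl ⟨u, mem_closedBall_zero_iff.2 (not_lt.1 hle), hzu⟩)
  have hu0 : u ≠ 0 := by
    rintro rfl
    rw [norm_zero] at hularge
    linarith
  have hn : 0 < ‖u‖ := norm_pos_iff.2 hu0
  set v : ℂ := ((‖u‖⁻¹ : ℝ) : ℂ) * u with hv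
  have hv1 : ‖v‖ = 1 := by
    rw [hv, norm_mul, Complex.norm_real, Real.norm_eq_abs, abs_of_pos (inv_pos.2 hn), inv_mul_cancel₀ hn.ne']
  obtain ⟨t, ht⟩ : ∃ t, T.Ci.β t = v := by
    have hfr : T.Ci.Φ v ∈ frontier R.carrier := T.Ci.apply_mem_frontier hv1
    rw [← R.range_boundary] at hfr
    obtain ⟨t, ht⟩ := hfr
    refine ⟨t, ?_⟩
    have h1 : T.Ci.Φ (T.Ci.β t) = T.Ci.Φ v := by rw [T.Ci.apply_β]; exact ht
    exact T.Ci.injOn (mem_closedBall_zero_iff.2 (T.Ci.norm_β t).le) (mem_closedBall_zero_iff.2 hv1.le) h1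
  have hu' : u = ((‖u‖ : ℝ) : ℂ) * T.Ci.β t := by
    rw [ht, hv, ← mul_assoc, ← Complex.ofReal_mul, mul_inv_cancel₀ hn.ne', Complex.ofReal_one, one_mul]
  have hzt : z = T.tube ‖u‖ t := by rw [← hzu, T.tube_of_le_one hu1.le, ← hu']
  obtain ⟨i, τ, hτ, hbτ, htube, -⟩ := R.exists_window T σp h t
  have hzτ : z = T.tube ‖u‖ τ := by rw [hzt, htube]
  have hzq : dist z (R.boundary τ) < tol := by rw [hzt, hbτ]; exact hdist _ _ hularge.le hu1.le
  have hwin : ∀ x ∈ Icc (R.mark i) (R.nextMark i), x ∈ Icc (R.mark 0 - 1) (R.mark 0 + 2) := fun x hx =>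
    ⟨by linarith [hx.1, (R.mark_zero_le_mark i).1], by linarith [hx.2, (R.mark_zero_le_mark i).2]⟩
  -- near a corner is excluded
  have hcorner : ∀ k : Fin 4, ∀ x ∈ Icc (R.mark i) (R.nextMark i), |τ - x| < κ → R.boundary x = R.pt k → False := by
    intro k x hx hτx hxk
    have h1 := hκ τ x (hwin τ hτ) (hwin x hx) hτx
    rw [hxk] at h1
    have := dist_triangle z (R.boundary τ) (R.pt k)
    linarith [hfar k, dist_nonneg (x := z) (y := R.boundary τ)]
  have hmem : ∀ {a b : ℝ}, τ ∈ Icc a b → (‖u‖, τ) ∈ Icc (0 : ℝ) 1 ×ˢ (Icc (R.mark 1 + κ / 2) (R.nextMark 1 - κ / 2) ∪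
      Icc (R.mark 3 + κ / 2) (R.nextMark 3 - κ / 2)) → False := fun _ hq =>
    hK (Or.inr ⟨(‖u‖, τ), hq, hzτ.symm⟩)
  have hq_arc : R.boundary τ ∈ R.arc i := ⟨τ, hτ, rfl⟩
  have hclose : infDist z (R.arc i) < tol := (infDist_le_dist_of_mem hq_arc).trans_lt hzq
  have hl' : ¬ τ < R.mark i + κ / 2 := fun hl => hcorner i (R.mark i) ⟨le_rfl, (R.mark_lt_nextMark i).le⟩
    (by rw [abs_lt]; constructor <;> linarith [hτ.1]) rfl
  have hr' : ¬ R.nextMark i - κ / 2 < τ := fun hr => hcorner (i + 1) (R.nextMark i) ⟨(R.mark_lt_nextMark i).le, le_rfl⟩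
    (by rw [abs_lt]; constructor <;> linarith [hτ.2]) (R.boundary_nextMark i)
  fin_cases i
  · exact Or.inl hclose
  · exact (hmem hτ ⟨⟨hn.le, hu1.le⟩, Or.inl ⟨not_lt.1 hl', not_lt.1 hr'⟩⟩).elim
  · exact Or.inr hclose
  · exact (hmem hτ ⟨⟨hn.le, hu1.le⟩, Or.inr ⟨not_lt.1 hl', not_lt.1 hr'⟩⟩).elim

/-- The filled compact is compact. [folklore] -/
theorem isCompact_fill (R : ConformalRectangle) (T : R.toJordanDomain.TubeData) {h : ℝ} (hh : 0 ≤ h) (κ : ℝ) :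
    IsCompact (T.Ci.Φ '' closedBall (0 : ℂ) (1 - 2 * h) ∪ (fun q : ℝ × ℝ => T.tube q.1 q.2) ''
      (Icc (0 : ℝ) 1 ×ˢ (Icc (R.mark 1 + κ / 2) (R.nextMark 1 - κ / 2) ∪ Icc (R.mark 3 + κ / 2) (R.nextMark 3 - κ / 2)))) := by
  refine ((isCompact_closedBall _ _).image_of_continuousOn
    (T.Ci.continuousOn.mono (closedBall_subset_closedBall (by linarith)))).union ?_
  exact (isCompact_Icc.prod (isCompact_Icc.union isCompact_Icc)).image_of_continuousOn
    (T.continuousOn_tube.mono fun q hq => ⟨by linarith [(mem_prod.1 hq).1.1], by linarith [(mem_prod.1 hq).1.2]⟩)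

/-- **The filled compact lies in the shorter–fatter collar domain**: the deep disc is inside, and so are
the closed tube rays of the inner parameter ranges of the pushed-out arcs `1`, `3`. [folklore] -/
theorem fill_subset_collarRect (R : ConformalRectangle) (T : R.toJordanDomain.TubeData) {h : ℝ} (hh : 0 < h)
    (hh1 : h ≤ 1 / 2)
    (hclose : ∀ t, dist (R.collarLoop T σp h t) (R.boundary t) < infDist T.z₀ (frontier R.carrier))
    {κ : ℝ} (hκ : 0 < κ) :
    T.Ci.Φ '' closedBall (0 : ℂ) (1 - 2 * h) ∪ (fun q : ℝ × ℝ => T.tube q.1 q.2) ''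
      (Icc (0 : ℝ) 1 ×ˢ (Icc (R.mark 1 + κ / 2) (R.nextMark 1 - κ / 2) ∪ Icc (R.mark 3 + κ / 2) (R.nextMark 3 - κ / 2))) ⊆
      (R.collarRect T (MarkedDomain.abs_le_one_of_sign σp_sign) hh hh1).carrier := by
  have hσ := MarkedDomain.abs_le_one_of_sign σp_sign
  rintro z (⟨u, hu, rfl⟩ | ⟨⟨s, τ⟩, hq, rfl⟩)
  · exact R.apply_mem_collarRect T hσ hh hh1 hclose (by have := mem_closedBall_zero_iff.1 hu; linarith)
  · obtain ⟨hs, hτ⟩ := mem_prod.1 hq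
    have key : ∀ i : Fin 4, σp i = 1 → τ ∈ Icc (R.mark i + κ / 2) (R.nextMark i - κ / 2) →
        T.tube s τ ∈ (R.collarRect T hσ hh hh1).carrier := by
      intro i hσi hτi
      have hIoo : τ ∈ Ioo (R.mark i) (R.nextMark i) := ⟨by linarith [hτi.1], by linarith [hτi.2]⟩
      obtain ⟨hp, hb⟩ := R.profile_of_mem_Ioo σp h hIoo
      refine R.tube_mem_collarRect T hσ hh hh1 hclose hs.1 ?_
      rw [hp, hσi, one_mul]
      have : 0 < h * MarkedDomain.bump (R.mark i) (R.nextMark i) τ := mul_pos hh hb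
      linarith [hs.2]
    rcases hτ with hτ | hτ
    · exact key 1 (by simp [σp]) hτ
    · exact key 3 (by simp [σp]) hτ

/-- **Points of `A₁ ∪ A₃` (arcs `0`, `2`) away from the corners keep off `A₂ ∪ A₄`.** [folklore] -/
theorem le_dist_of_mem_arc_zero_two (R : ConformalRectangle) {ρ κ d₁ : ℝ}
    (hκ : ∀ τ τ' : ℝ, τ ∈ Icc (R.mark 0 - 1) (R.mark 0 + 2) → τ' ∈ Icc (R.mark 0 - 1) (R.mark 0 + 2) →
      |τ - τ'| < κ → dist (R.boundary τ) (R.boundary τ') < ρ / 4)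
    (hsep : ∀ w ∈ Icc (R.mark 0 + κ / 2) (R.mark 1 - κ / 2) ∪ Icc (R.mark 2 + κ / 2) (R.mark 3 - κ / 2),
      ∀ b ∈ R.arc 1 ∪ R.arc 3, d₁ ≤ dist (R.boundary w) b)
    {q : ℂ} (hq : q ∈ R.arc 0 ∨ q ∈ R.arc 2) (hfar : ∀ i, ρ / 2 ≤ dist q (R.pt i)) :
    ∀ b ∈ R.arc 1 ∪ R.arc 3, d₁ ≤ dist q b := by
  obtain ⟨n0, n1, n2, n3⟩ := R.nextMarks_eq
  have main : ∀ i : Fin 4, (i = 0 ∨ i = 2) → q ∈ R.arc i →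
      ∃ w ∈ Icc (R.mark i + κ / 2) (R.nextMark i - κ / 2), R.boundary w = q := by
    rintro i hi ⟨w, hw, rfl⟩
    have hwin : ∀ x ∈ Icc (R.mark i) (R.nextMark i), x ∈ Icc (R.mark 0 - 1) (R.mark 0 + 2) := fun x hx =>
      ⟨by linarith [hx.1, (R.mark_zero_le_mark i).1], by linarith [hx.2, (R.mark_zero_le_mark i).2]⟩
    refine ⟨w, ⟨?_, ?_⟩, rfl⟩
    · by_contra hlt
      push Not at hlt
      have h1 := hκ w (R.mark i) (hwin w hw) (hwin _ ⟨le_rfl, (R.mark_lt_nextMark i).le⟩)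
        (by rw [abs_lt]; constructor <;> linarith [hw.1])
      have := hfar i
      rw [MarkedDomain.pt] at this
      linarith [dist_nonneg (x := R.boundary w) (y := R.boundary (R.mark i))]
    · by_contra hlt
      push Not at hlt
      have h1 := hκ w (R.nextMark i) (hwin w hw) (hwin _ ⟨(R.mark_lt_nextMark i).le, le_rfl⟩)
        (by rw [abs_lt]; constructor <;> linarith [hw.2])
      rw [R.boundary_nextMark] at h1
      linarith [hfar (i + 1), dist_nonneg (x := R.boundary w) (y := R.pt (i + 1))]
  intro b hb
  rcases hq with hq | hq
  · obtain ⟨w, hw, rfl⟩ := main 0 (Or.inl rfl) hq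
    rw [n0] at hw
    exact hsep w (Or.inl hw) b hb
  · obtain ⟨w, hw, rfl⟩ := main 2 (Or.inr rfl) hq
    rw [n2] at hw
    exact hsep w (Or.inr hw) b hb

end Summit.CriticalPhenomena.CardyFormulaZ2.Theorems.IKLinearTransport.PinnedDiagramExchange
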